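import Literature.AlgebraicGeometry.Resolution.ArithmeticalThreefoldsLocalPolyhedron
import Literature.AlgebraicGeometry.Resolution.ArithmeticalThreefoldsLocalProofs
import Mathlib.RingTheory.Filtration
import Mathlib.Algebra.Polynomial.Taylor
import Mathlib.Algebra.Polynomial.HasseDeriv
import Mathlib.Tactic.Linarith
import HarnessLib

/-!
# Cossart–Piltant 2019, Ch. 2: the polyhedron `Δ_S(h; u; X)` — validation of the rendering

Topic: `Literature/AlgebraicGeometry/Resolution` (proofs only). Companion of
`ArithmeticalThreefoldsLocalPolyhedron.lean`, which DEFINES `I_α(a)`, `μ_α`, `δ_α(h; u; X)` and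
`Δ_S(h; u; X)` (Cossart–Piltant, *Resolution of singularities of arithmetical threefolds*,
arXiv v1 pp. 9–10) with `Δ` rendered through its support function. Here we PROVE, for that
rendering, the paper's Remark 2.1 (v1 p. 10):

> "`Δ_S(h; {u_j}_{j ∈ J}; X) = ∅ ⟺ h = X^m`."

in the form: for `S` Noetherian local and `u_j ∈ m_S`, `Δ_S(h; u; X) = ∅` iff all
`f_{i,X} = 0`, `1 ≤ i ≤ m` (`charPolyhedron_eq_empty_iff`). Ingredients: `|x|_α ≤ (Σα)(Σx)`, so
`I_α(a) ⊆ (u)^⌈a / Σα⌉` (`monomialIdeal_le_span_pow_ceil_div`), and Krull's intersection theorem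
(Mathlib `Ideal.iInf_pow_eq_bot_of_isLocalRing`): an `f ∈ ⋂_a I_α(a)` is `0`
(`eq_zero_of_forall_mem_monomialIdeal`), while a nonzero `f_{i,X} ∉ m_S^N` puts the point
`(N, …, N)` in `Δ`.

## Sources

* V. Cossart, O. Piltant, J. Algebra 529 (2019) 268–535 = arXiv:1412.0868, Ch. 2, v1 p. 9
  (`I_α(a)`, `μ_α`) and p. 10 (Def. 2.1, Remark 2.1). [CossartPiltant2019]
-/

noncomputable section

open Polynomial Finset

namespace Literature.AlgebraicGeometry.Resolution.CossartPiltant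

universe u

variable {S : Type u} [CommRing S] {n : ℕ}

/-! ## Validation of the rendering: Remark 2.1, `Δ_S(h; u; X) = ∅ ⟺ h = X^m` -/

/-- `I_α(a) I_α(b) ⊆ I_α(a + b)`, elementwise. [cite: CossartPiltant2019, Ch. 2 (arXiv v1 p. 9)] -/
theorem mul_mem_monomialIdeal_add {u : Fin n → S} {α : Fin n → ℝ} {a b : ℝ} {f g : S}
    (hf : f ∈ monomialIdeal u α a) (hg : g ∈ monomialIdeal u α b) :
    f * g ∈ monomialIdeal u α (a + b) :=
  monomialIdeal_mul_le u α a b (Ideal.mul_mem_mul hf hg)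

/-- `|x|_α ≤ (Σ_j α_j) · (Σ_j x_j)` for `α ≥ 0`. [folklore] -/
theorem weight_le_sum_mul_sum {α : Fin n → ℝ} (hα : ∀ j, 0 ≤ α j) (x : Fin n → ℕ) :
    weight α x ≤ (∑ j, α j) * ((∑ j, x j : ℕ) : ℝ) := by
  rw [weight, Finset.sum_mul]
  refine Finset.sum_le_sum fun j _ => mul_le_mul_of_nonneg_left ?_ (hα j)
  exact_mod_cast Finset.single_le_sum (f := x) (fun i _ => Nat.zero_le _) (Finset.mem_univ j)

/-- For `α ≥ 0` with `A := Σ_j α_j > 0`: `I_α(a) ⊆ (u)^⌈a / A⌉` — a monomial `u^x` of `α`-weight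
`≥ a` has total degree `Σ x_j ≥ a / A`. [cite: CossartPiltant2019, Ch. 2 (arXiv v1 p. 9)] -/
theorem monomialIdeal_le_span_pow_ceil_div (u : Fin n → S) {α : Fin n → ℝ} (hα : ∀ j, 0 ≤ α j)
    (hA : 0 < ∑ j, α j) (a : ℝ) :
    monomialIdeal u α a ≤ Ideal.span (Set.range u) ^ ⌈a / ∑ j, α j⌉₊ := by
  apply Ideal.span_le.mpr
  rintro _ ⟨x, hx, rfl⟩
  refine uPow_mem_span_pow u (Nat.ceil_le.mpr ?_)
  rw [div_le_iff₀ hA, mul_comm]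
  exact hx.trans (weight_le_sum_mul_sum hα x)

/-- If all weights vanish (`Σ_j α_j = 0` with `α ≥ 0`, e.g. `n = 0`), then `I_α(a) = 0` for
`a > 0` (no monomial has positive weight) — in a nontrivial way only `I_α(a) ≤ ⊥`. [folklore] -/
theorem monomialIdeal_eq_bot_of_sum_eq_zero (u : Fin n → S) {α : Fin n → ℝ} (hα : ∀ j, 0 ≤ α j)
    (hA : ∑ j, α j = 0) {a : ℝ} (ha : 0 < a) : monomialIdeal u α a = ⊥ := by
  rw [monomialIdeal, Ideal.span_eq_bot]
  rintro _ ⟨x, hx, rfl⟩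
  exfalso
  have := hx.trans (weight_le_sum_mul_sum hα x)
  rw [hA, zero_mul] at this
  exact absurd this (not_le.mpr ha)

/-- An element lying in `I_α(a)` for every `a` (fixed weight `α > 0`… in fact `α ≥ 0`) is `0`,
for `S` Noetherian local with the `u_j` in the maximal ideal (Krull's intersection theorem).
[cite: CossartPiltant2019, Ch. 2 (arXiv v1 p. 9)] -/
theorem eq_zero_of_forall_mem_monomialIdeal [IsNoetherianRing S] [IsLocalRing S] {u : Fin n → S}
    (hu : ∀ j, u j ∈ IsLocalRing.maximalIdeal S) {α : Fin n → ℝ} (hα : ∀ j, 0 ≤ α j) {f : S}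
    (hf : ∀ a : ℝ, f ∈ monomialIdeal u α a) : f = 0 := by
  rcases (Finset.sum_nonneg fun j (_ : j ∈ Finset.univ) => hα j).eq_or_lt with hA | hA
  · have := hf 1
    rwa [monomialIdeal_eq_bot_of_sum_eq_zero u hα hA.symm one_pos, Ideal.mem_bot] at this
  have hspan : Ideal.span (Set.range u) ≤ IsLocalRing.maximalIdeal S :=
    Ideal.span_le.mpr (by rintro _ ⟨j, rfl⟩; exact hu j)
  have hkrull : ⨅ k : ℕ, IsLocalRing.maximalIdeal S ^ k = ⊥ :=
    Ideal.iInf_pow_eq_bot_of_isLocalRing _ (IsLocalRing.maximalIdeal.isMaximal S).ne_top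
  have hmem : f ∈ ⨅ k : ℕ, IsLocalRing.maximalIdeal S ^ k := by
    rw [Ideal.mem_iInf]
    intro k
    have h1 := monomialIdeal_le_span_pow_ceil_div u hα hA ((k : ℝ) * ∑ j, α j) (hf _)
    rw [mul_div_cancel_right₀ _ hA.ne', Nat.ceil_natCast] at h1
    exact Ideal.pow_right_mono hspan k h1
  rwa [hkrull, Ideal.mem_bot] at hmem

/-- **Remark 2.1, "`Δ_S(h; u; X) = ∅ ⟺ h = X^m`"**, for the rendered `Δ`: for `S` Noetherian local
and `u_j ∈ m_S`, `Δ_S(h; u; X)` is empty iff all `f_{i,X} = 0` (`1 ≤ i ≤ m = deg h`), i.e. iff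
`h` is its leading monomial. (Validation of the rendering against Cossart–Piltant 2019, v1 p. 10,
Remark 2.1.) [cite: CossartPiltant2019, Remark 2.1 (arXiv v1 p. 10)] -/
theorem charPolyhedron_eq_empty_iff [IsNoetherianRing S] [IsLocalRing S] {u : Fin n → S}
    (hu : ∀ j, u j ∈ IsLocalRing.maximalIdeal S) (h : S[X]) :
    charPolyhedron u h = ∅ ↔ ∀ i ∈ Finset.Icc 1 h.natDegree, h.coeff (h.natDegree - i) = 0 := by
  constructor
  · intro hempty i hi
    by_contra hfi
    -- `f_i ∉ 𝔪^N` for some `N` (Krull)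
    have hkrull : ⨅ k : ℕ, IsLocalRing.maximalIdeal S ^ k = ⊥ :=
      Ideal.iInf_pow_eq_bot_of_isLocalRing _ (IsLocalRing.maximalIdeal.isMaximal S).ne_top
    have : ∃ N : ℕ, h.coeff (h.natDegree - i) ∉ IsLocalRing.maximalIdeal S ^ N := by
      by_contra hall
      push Not at hall
      apply hfi
      have : h.coeff (h.natDegree - i) ∈ ⨅ k : ℕ, IsLocalRing.maximalIdeal S ^ k :=
        Ideal.mem_iInf.mpr hall
      rwa [hkrull, Ideal.mem_bot] at this
    obtain ⟨N, hN⟩ := this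
    have hspan : Ideal.span (Set.range u) ≤ IsLocalRing.maximalIdeal S :=
      Ideal.span_le.mpr (by rintro _ ⟨j, rfl⟩; exact hu j)
    have hi1 : (1 : ℝ) ≤ i := by exact_mod_cast (Finset.mem_Icc.mp hi).1
    -- the point `(N, …, N)` lies in `Δ`: for every `α > 0`, `δ_α ≥ q` forces `q ≤ N Σ_j α_j`
    have hmem : (fun _ : Fin n => (N : ℝ)) ∈ charPolyhedron u h := by
      refine ⟨fun _ => Nat.cast_nonneg N, fun α hα q hq => ?_⟩
      have hα' : ∀ j, 0 ≤ α j := fun j => (hα j).le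
      have hsum : ∑ j, α j * (N : ℝ) = (∑ j, α j) * N := by rw [Finset.sum_mul]
      rw [hsum]
      by_cases hq0 : q ≤ 0
      · exact hq0.trans (mul_nonneg (Finset.sum_nonneg fun j _ => hα' j) (Nat.cast_nonneg N))
      push Not at hq0
      have hiq : 0 < (i : ℝ) * q := mul_pos (by linarith) hq0
      rcases (Finset.sum_nonneg fun j (_ : j ∈ Finset.univ) => hα' j).eq_or_lt with hA | hA
      · -- no weights: `I_α(i q) = ⊥`, so `f_i = 0`, contradiction
        exfalso
        have := hq i hi
        rw [monomialIdeal_eq_bot_of_sum_eq_zero u hα' hA.symm hiq, Ideal.mem_bot] at this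
        exact hfi this
      -- `f_i ∈ I_α(i q) ⊆ 𝔪^⌈i q / A⌉` and `f_i ∉ 𝔪^N` give `i q / A < N`
      have h1 := Ideal.pow_right_mono hspan _
        (monomialIdeal_le_span_pow_ceil_div u hα' hA ((i : ℝ) * q) (hq i hi))
      have hlt : (i : ℝ) * q / ∑ j, α j < N := by
        by_contra hge
        push Not at hge
        have : N ≤ ⌈(i : ℝ) * q / ∑ j, α j⌉₊ := by exact_mod_cast hge.trans (Nat.le_ceil _)
        exact hN (Ideal.pow_le_pow_right this h1)
      rw [div_lt_iff₀ hA] at hlt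
      nlinarith
    rw [hempty] at hmem
    exact hmem
  · intro hzero
    apply Set.eq_empty_of_forall_notMem
    intro x hx
    have hall : ∀ q : ℝ, DeltaGE u (fun _ => (1 : ℝ)) h q := fun q i hi => by
      rw [hzero i hi]
      exact Ideal.zero_mem _
    have := hx.2 (fun _ => (1 : ℝ)) (fun _ => one_pos) (∑ j, (1 : ℝ) * x j + 1) (hall _)
    linarith

/-! ## `δ_𝟙(h; u; X) ≥ 1 ⟺ x = (m_S, X) ∈ Sing_m 𝒳` -/

/-- **`δ_𝟙(h; u; X) ≥ 1 ⟺ ord_x h ≥ m` at `x = (m_S, X)`** (Cossart–Piltant 2019, v1 p. 11,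
Prop. 2.3 (ii) "`δ_𝟙(h; u; Z) ≥ 1 ⟺ η⁻¹(m_S) ∩ Sing_m 𝒳 ≠ ∅`", in the given coordinate `X`, where
no minimality is needed): for a local ring `S` whose maximal ideal is generated by `u₁, …, u_n`,
`h ∈ S[X]` of degree `m`, and `S'` the local ring of `S[X]` at the closed point `𝔑 = (m_S, X)`:
`δ_𝟙(h; u; X) ≥ 1` iff `h/1 ∈ (𝔑 S')^m`, i.e. iff `m(x) = ord_x h ≥ m` (`= m` for `h` monic,
`Polynomial.Monic.le_natDegree_of_algebraMap_mem_maximalIdeal_pow`). Combines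
`deltaGE_one_one_iff` with `Polynomial.algebraMap_mem_maximalIdeal_pow_natDegree_iff`
(`ArithmeticalThreefoldsLocalProofs.lean`). [cite: CossartPiltant2019, Prop. 2.3 (arXiv v1 p. 11)] -/
theorem deltaGE_one_one_iff_algebraMap_mem_maximalIdeal_pow [IsLocalRing S] {u : Fin n → S}
    (hu : Ideal.span (Set.range u) = IsLocalRing.maximalIdeal S) (h : S[X])
    (S' : Type*) [CommRing S'] [Algebra S[X] S']
    [hN : ((IsLocalRing.maximalIdeal S).map (C : S →+* S[X]) ⊔ Ideal.span {X - C (0 : S)}).IsMaximal]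
    [IsLocalization.AtPrime S'
      ((IsLocalRing.maximalIdeal S).map (C : S →+* S[X]) ⊔ Ideal.span {X - C (0 : S)})]
    [IsLocalRing S'] :
    DeltaGE u (fun _ => (1 : ℝ)) h 1 ↔
      algebraMap S[X] S' h ∈ IsLocalRing.maximalIdeal S' ^ h.natDegree := by
  rw [deltaGE_one_one_iff hu,
    Polynomial.algebraMap_mem_maximalIdeal_pow_natDegree_iff (𝔞 := IsLocalRing.maximalIdeal S)
      (0 : S) S', taylor_zero]

/-! ## Translations `X ↦ X + θ` with `μ_α(θ) ≥ q` do not lower `δ_α` below `q` -/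

/-- `θ ∈ I_α(q) ⇒ θ^j ∈ I_α(j q)`. [cite: CossartPiltant2019, Ch. 2 (arXiv v1 p. 9)] -/
theorem pow_mem_monomialIdeal {u : Fin n → S} {α : Fin n → ℝ} {q : ℝ} {θ : S}
    (hθ : θ ∈ monomialIdeal u α q) (j : ℕ) : θ ^ j ∈ monomialIdeal u α (j * q) := by
  induction j with
  | zero =>
    rw [pow_zero, Nat.cast_zero, zero_mul, monomialIdeal_of_nonpos u α le_rfl]
    exact Submodule.mem_top
  | succ j ih =>
    rw [pow_succ, Nat.cast_succ, add_mul, one_mul]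
    exact mul_mem_monomialIdeal_add ih hθ

/-- **`δ_α(h; u; X) ≥ q` is stable under `X ↦ X + θ` for `θ ∈ I_α(q)`** (i.e. `μ_α(θ) ≥ q`):
if `f_{i,X} ∈ I_α(iq)` for all `i` and `h` is monic, then the coefficients `f_{i,X'}` of
`h(X + θ)` (the expansion (2.3) of v1 p. 9 in `X' = X - (-θ)`) again satisfy
`f_{i,X'} ∈ I_α(iq)` — each term `C(m-j, i-j) f_{j,X} θ^{i-j}` of (2.3) lies in
`I_α(jq) I_α(q)^{i-j} ⊆ I_α(iq)`. This is the mechanism behind Prop. 2.3 and §2.3 of the paper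
(v1 p. 15: "By minimality, we have `μ_α(φ) ≥ a := δ_α(h; u; Z)` … `in_α h(Z') = in_α h(Z - cl_{α,a} φ)`").
[cite: CossartPiltant2019, Prop. 2.3 (proof) (arXiv v1 pp. 11–12, 15)] -/
theorem DeltaGE.taylor {u : Fin n → S} {α : Fin n → ℝ} {h : S[X]} (hh : h.Monic) {q : ℝ}
    {θ : S} (hθ : θ ∈ monomialIdeal u α q) (H : DeltaGE u α h q) :
    DeltaGE u α (Polynomial.taylor θ h) q := by
  intro i hi
  rw [natDegree_taylor] at hi ⊢
  obtain ⟨hi1, him⟩ := Finset.mem_Icc.mp hi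
  rw [taylor_coeff, eval_eq_sum_range]
  refine Submodule.sum_mem _ fun j _ => ?_
  rw [hasseDeriv_coeff]
  -- the coefficient `h.coeff (j + (m - i))`
  rcases lt_trichotomy j i with hji | rfl | hij
  · -- `j < i`: `h.coeff (m - (i - j)) ∈ I_α((i - j) q)` and `θ^j ∈ I_α(j q)`
    have hidx : j + (h.natDegree - i) = h.natDegree - (i - j) := by omega
    have hmem : h.coeff (j + (h.natDegree - i)) ∈ monomialIdeal u α ((i - j : ℕ) * q) := by
      rw [hidx]
      exact H (i - j) (Finset.mem_Icc.mpr ⟨by omega, by omega⟩)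
    have hprod := mul_mem_monomialIdeal_add hmem (pow_mem_monomialIdeal hθ j)
    have hq : ((i - j : ℕ) : ℝ) * q + (j : ℝ) * q = (i : ℝ) * q := by
      rw [← add_mul, ← Nat.cast_add, Nat.sub_add_cancel hji.le]
    rw [hq] at hprod
    rw [mul_assoc]
    exact Ideal.mul_mem_left _ _ hprod
  · -- `j = i`: the leading coefficient `h.coeff m = 1`, and `θ^i ∈ I_α(i q)`
    have hidx : j + (h.natDegree - j) = h.natDegree := by omega
    rw [hidx, show h.coeff h.natDegree = 1 from hh, mul_one]
    exact Ideal.mul_mem_left _ _ (pow_mem_monomialIdeal hθ j)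
  · -- `j > i`: the coefficient vanishes
    have : h.coeff (j + (h.natDegree - i)) = 0 := coeff_eq_zero_of_natDegree_lt (by omega)
    rw [this, mul_zero, zero_mul]
    exact Ideal.zero_mem _

/-- **`δ_α ≥ q` is invariant under `X ↦ X + θ` for `θ ∈ I_α(q)`** (both directions, `h`
monic): translating back by `-θ ∈ I_α(q)`. [cite: CossartPiltant2019, Prop. 2.3 (proof) (arXiv v1 pp. 11–12, 15)] -/
theorem DeltaGE.taylor_iff {u : Fin n → S} {α : Fin n → ℝ} {h : S[X]} (hh : h.Monic) {q : ℝ}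
    {θ : S} (hθ : θ ∈ monomialIdeal u α q) :
    DeltaGE u α (Polynomial.taylor θ h) q ↔ DeltaGE u α h q := by
  refine ⟨fun H => ?_, DeltaGE.taylor hh hθ⟩
  have hh' : (Polynomial.taylor θ h).Monic := by
    rw [Monic, leadingCoeff_taylor]
    exact hh
  have := DeltaGE.taylor hh' ((Ideal.neg_mem_iff _).mpr hθ) H
  rwa [taylor_taylor, neg_add_cancel, taylor_zero] at this

/-! ## Changing the parameters by units -/

/-- Replacing each `u_j` by an associate (a unit multiple) does not change the ideals `I_α(a)`:
they only depend on the ideals `(u_j)` — in the paper, on the normal crossings divisor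
`E = div(u₁ ⋯ u_e)` and the r.s.p. up to units. [cite: CossartPiltant2019, Ch. 2 (arXiv v1 p. 9)] -/
theorem monomialIdeal_eq_of_associated {u v : Fin n → S} (huv : ∀ j, Associated (u j) (v j))
    (α : Fin n → ℝ) (a : ℝ) : monomialIdeal u α a = monomialIdeal v α a := by
  -- `v^x` is a unit multiple of `u^x`
  have key : ∀ {u v : Fin n → S}, (∀ j, Associated (u j) (v j)) →
      monomialIdeal v α a ≤ monomialIdeal u α a := by
    intro u v huv
    apply Ideal.span_le.mpr
    rintro _ ⟨x, hx, rfl⟩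
    have hassoc : Associated (uPow u x) (uPow v x) := by
      unfold uPow
      exact Associated.prod _ _ _ fun j _ => (huv j).pow_pow
    obtain ⟨ε, hε⟩ := hassoc
    rw [SetLike.mem_coe, ← hε]
    exact Ideal.mul_mem_right _ _ (uPow_mem_monomialIdeal u hx)
  exact le_antisymm (key fun j => (huv j).symm) (key huv)

/-- Hence `δ_α(h; u; X) ≥ q` only depends on the `u_j` up to units. [cite: CossartPiltant2019, Def. 2.2 (arXiv v1 p. 10)] -/
theorem deltaGE_iff_of_associated {u v : Fin n → S} (huv : ∀ j, Associated (u j) (v j))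
    (α : Fin n → ℝ) (h : S[X]) (q : ℝ) : DeltaGE u α h q ↔ DeltaGE v α h q := by
  simp only [DeltaGE, monomialIdeal_eq_of_associated huv]

/-! ## (2.6): the polyhedron of a sub-family `(u_j)_{j ∈ J}` via weight vectors vanishing off `J` -/

/-- Monomials in a sub-family `u ∘ ι` are monomials in `u` with exponents extended by zero.
[folklore] -/
theorem uPow_comp_eq_uPow_extend {m : ℕ} (u : Fin n → S) {ι : Fin m → Fin n}
    (hι : Function.Injective ι) (x : Fin m → ℕ) :
    uPow (u ∘ ι) x = uPow u (Function.extend ι x 0) := by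
  classical
  unfold uPow
  -- split the product over `Fin n` into the image of `ι` and its complement
  rw [← Finset.prod_subset (Finset.subset_univ (Finset.univ.image ι))]
  · rw [Finset.prod_image fun a _ b _ h => hι h]
    refine Finset.prod_congr rfl fun i _ => ?_
    rw [Function.comp_apply, hι.extend_apply]
  · intro j _ hj
    have : ¬ ∃ i, ι i = j := fun ⟨i, hi⟩ => hj (Finset.mem_image.mpr ⟨i, Finset.mem_univ _, hi⟩)
    rw [Function.extend_apply' _ _ _ this, Pi.zero_apply, pow_zero]

/-- Weights of extended exponents: `|extend x|_{extend α'} = |x|_{α'}`. [folklore] -/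
theorem weight_extend_extend {m : ℕ} {ι : Fin m → Fin n} (hι : Function.Injective ι)
    (α' : Fin m → ℝ) (x : Fin m → ℕ) :
    weight (Function.extend ι α' 0) (Function.extend ι x 0) = weight α' x := by
  classical
  unfold weight
  rw [← Finset.sum_subset (Finset.subset_univ (Finset.univ.image ι))]
  · rw [Finset.sum_image fun a _ b _ h => hι h]
    refine Finset.sum_congr rfl fun i _ => ?_
    rw [hι.extend_apply, hι.extend_apply]
  · intro j _ hj
    have : ¬ ∃ i, ι i = j := fun ⟨i, hi⟩ => hj (Finset.mem_image.mpr ⟨i, Finset.mem_univ _, hi⟩)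
    rw [Function.extend_apply' _ _ _ this, Pi.zero_apply, zero_mul]

/-- The weight of an arbitrary exponent for a weight vector vanishing off the image of `ι` only
sees the restriction to the image. [folklore] -/
theorem weight_extend_eq_weight_comp {m : ℕ} {ι : Fin m → Fin n} (hι : Function.Injective ι)
    (α' : Fin m → ℝ) (x : Fin n → ℕ) :
    weight (Function.extend ι α' 0) x = weight α' (x ∘ ι) := by
  classical
  unfold weight
  rw [← Finset.sum_subset (Finset.subset_univ (Finset.univ.image ι))]
  · rw [Finset.sum_image fun a _ b _ h => hι h]
    refine Finset.sum_congr rfl fun i _ => ?_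
    rw [hι.extend_apply, Function.comp_apply]
  · intro j _ hj
    have : ¬ ∃ i, ι i = j := fun ⟨i, hi⟩ => hj (Finset.mem_image.mpr ⟨i, Finset.mem_univ _, hi⟩)
    rw [Function.extend_apply' _ _ _ this, Pi.zero_apply, zero_mul]

/-- **(2.6) at the level of the monomial filtrations**: `I_{α'}(a)` for the sub-family
`(u_j)_{j ∈ J}` equals `I_α(a)` for the full family with the weight vector `α` extending `α'` by
zero. [cite: CossartPiltant2019, (2.6) (arXiv v1 p. 11)] -/
theorem monomialIdeal_comp_eq_monomialIdeal_extend {m : ℕ} (u : Fin n → S) {ι : Fin m → Fin n}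
    (hι : Function.Injective ι) (α' : Fin m → ℝ) (a : ℝ) :
    monomialIdeal (u ∘ ι) α' a = monomialIdeal u (Function.extend ι α' 0) a := by
  classical
  apply le_antisymm
  · unfold monomialIdeal
    refine Ideal.span_le.mpr ?_
    rintro _ ⟨x, hx, rfl⟩
    rw [uPow_comp_eq_uPow_extend u hι]
    refine uPow_mem_monomialIdeal u ?_
    rwa [weight_extend_extend hι]
  · unfold monomialIdeal
    refine Ideal.span_le.mpr ?_
    rintro _ ⟨x, hx, rfl⟩
    rw [weight_extend_eq_weight_comp hι] at hx
    -- `u^x = (u ∘ ι)^{x ∘ ι} · ∏_{j ∉ im ι} u_j^{x_j}`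
    have hdvd : uPow (u ∘ ι) (x ∘ ι) ∣ uPow u x := by
      rw [uPow_comp_eq_uPow_extend u hι]
      refine ⟨uPow u (x - Function.extend ι (x ∘ ι) 0), ?_⟩
      rw [← uPow_add]
      congr 1
      funext j
      by_cases hj : ∃ i, ι i = j
      · obtain ⟨i, rfl⟩ := hj
        simp only [Pi.add_apply, Pi.sub_apply, hι.extend_apply, Function.comp_apply]
        omega
      · simp only [Pi.add_apply, Pi.sub_apply, Function.extend_apply' _ _ _ hj, Pi.zero_apply]
        omega
    obtain ⟨c, hc⟩ := hdvd
    show uPow u x ∈ monomialIdeal (u ∘ ι) α' a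
    rw [hc]
    exact Ideal.mul_mem_right _ _ (uPow_mem_monomialIdeal _ hx)

/-- **(2.6): `Δ_S(h; (u_j)_{j ∈ J}; X) = pr^J Δ_S(h; u; X)`** in the form
"`δ_{α'}(h; u_J; X) ≥ q ⟺ δ_α(h; u; X) ≥ q`" for the weight vector `α` extending `α'` by zero
off `J`. [cite: CossartPiltant2019, (2.6) (arXiv v1 p. 11)] -/
theorem deltaGE_comp_iff {m : ℕ} (u : Fin n → S) {ι : Fin m → Fin n}
    (hι : Function.Injective ι) (α' : Fin m → ℝ) (h : S[X]) (q : ℝ) :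
    DeltaGE (u ∘ ι) α' h q ↔ DeltaGE u (Function.extend ι α' 0) h q := by
  simp only [DeltaGE, monomialIdeal_comp_eq_monomialIdeal_extend u hι]

end Literature.AlgebraicGeometry.Resolution.CossartPiltant

end
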